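import Mathlib
import HarnessLib
import Literature.NumberTheory.Transcendental.KZCalculus
import Literature.NumberTheory.Transcendental.AnalyticSubgroupElliptic
import Literature.NumberTheory.Transcendental.PeriodsWave0
import Summits.KontsevichZagierPeriods.KontsevichZagierPeriods.Theses.SymplecticScissors

/-!
# Sketch — crux-ideate stmt-KontsevichZagierPeriods-9847 (PlanarK0Injective), ideator 2, round 1

Vocabulary and first lemmas of the two idea cards (statements only ELABORATE; the one `theorem`
is the purely logical composition showing that card A's three stubs conclude the crux BY NAME).

Card A `real-subgroup-square-certificate`:
* `IsGreenSquareData F A B` — a Green certificate for the signed cell of `F` on the unit square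
  (closed semialgebraic 1-form `A ds + B dt`, C¹ off a null semialgebraic wall set, edge traces
  `B(0,·) = F`, `B(1,·) = 0`, `A(·,0) = A(·,1) = 0`);
* `GreenSquareCertificate` (the TRANSFER C⁺, transcendence + reality + homotopy packaged as ONE
  existential statement over real semialgebraic functions): every bounded semialgebraic `F` on
  `(0,1)` with `∫ F = 0` has such a certificate;
* `GreenSquareRealisation` (the planar engine: equal-Jacobian shears + slice-degree bookkeeping +
  indicator criterion): a certificate puts the signed cell of `F` into the planar group;
* `CellNormalForm` (planar, transcendence-free): `[r] − [r′]` ≡ signed cell of one bounded `F` with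
  `∫F = value r − value r′`;
* `planarK0Injective_of` : the three imply `SymplecticScissors.PlanarK0Injective` (logic only);
* `EllipticCellsK0_of_AST` — the typed-today LAYER of the same lever (one non-CM elliptic curve;
  input `analyticSubgroupTheorem_GaGmE`; no Green instance needed because `E(ℝ)` is 1-dimensional).

Card B `liouvillian-cells-baker`:
* `PlanarBaker_of_baker` — rectangles + log-cells + arctan-cells, input `baker` (PROVED in the tree:
  `baker_holds`), hence an unconditional theorem candidate modulo planar bookkeeping.

Calibration: `TwistCalibration` (reality principle: `∫_{-1}^∞ dx/√(x³+1) = √3 ∫_1^∞ dx/√(x³−1)` by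
the REAL 3-isogeny, numerically 4.2065463159… = 1.7320508075688… × 2.4286506478…).
-/

noncomputable section

open scoped BigOperators Topology
open Set MeasureTheory Filter

namespace Summit.KontsevichZagierPeriods.KontsevichZagierPeriods.Cruxes.PlanarK0Injective.Ideator2

open Literature.NumberTheory.Transcendental

/-- The planar set-chain group of the crux (verbatim the subgroup in
`SymplecticScissors.PlanarK0Injective`). -/
def planarGroup : AddSubgroup KZ.FormalRep :=
  AddSubgroup.closure ((KZ.domainAddRel ∪ KZ.changeOfVariablesRel) ∩
    (AddSubgroup.closure {x : KZ.FormalRep | ∃ s : KZ.IntegralRep 2,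
      (∀ p ∈ s.domain, s.integrand p = 1) ∧ x = KZ.of s} : Set KZ.FormalRep))

/-- The open unit square; coordinates `p 0 = s` (homotopy parameter), `p 1 = t` (path parameter). -/
def openSquare : Set (Fin 2 → ℝ) := {p | 0 < p 0 ∧ p 0 < 1 ∧ 0 < p 1 ∧ p 1 < 1}

/-- GREEN CERTIFICATE DATA on the unit square for the signed cell of `F : (0,1) → ℝ`:
`A ds + B dt` is ℚ-semialgebraic on the open square, `C¹` with `∂_t A = ∂_s B` on an open
semialgebraic set `W` of full measure (walls allowed), `∂_t A` integrable (the swept area is finite),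
and the slice/trace clause that the planar bookkeeping needs: `t ↦ A(s,t)` continuous on `(0,1)`
with limits `0` at both ends (the `s`-edges are constant paths), `s ↦ B(s,t)` continuous on `(0,1)`
with limit `F t` at `s = 0` (the given path) and `0` at `s = 1` (the path inside the real subgroup
killed by the form) for a.e. `t`. This clause is the tunable joint between the two stubs below. -/
def IsGreenSquareData (F : ℝ → ℝ) (A B : (Fin 2 → ℝ) → ℝ) : Prop :=
  IsSemialgebraicFunOn ℚ openSquare A ∧ IsSemialgebraicFunOn ℚ openSquare B ∧
  (∃ W : Set (Fin 2 → ℝ), IsOpen W ∧ W ⊆ openSquare ∧ volume (openSquare \ W) = 0 ∧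
    Literature.ModelTheory.ExponentialFields.IsSemialgebraic ℚ W ∧
    ContDiffOn ℝ 1 A W ∧ ContDiffOn ℝ 1 B W ∧
    (∀ p ∈ W, fderiv ℝ A p (Pi.single 1 1) = fderiv ℝ B p (Pi.single 0 1)) ∧
    IntegrableOn (fun p => fderiv ℝ A p (Pi.single 1 1)) W) ∧
  (∀ s ∈ Ioo (0:ℝ) 1, ContinuousOn (fun t : ℝ => A ![s, t]) (Ioo 0 1) ∧
    Tendsto (fun t : ℝ => A ![s, t]) (𝓝[>] 0) (𝓝 0) ∧
    Tendsto (fun t : ℝ => A ![s, t]) (𝓝[<] 1) (𝓝 0)) ∧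
  (∀ᵐ t ∂(volume.restrict (Ioo (0:ℝ) 1)), ContinuousOn (fun s : ℝ => B ![s, t]) (Ioo 0 1) ∧
    Tendsto (fun s : ℝ => B ![s, t]) (𝓝[>] 0) (𝓝 (F t)) ∧
    Tendsto (fun s : ℝ => B ![s, t]) (𝓝[<] 1) (𝓝 0))

/-- TRANSFER C⁺ of card A — THE GREEN-SQUARE CERTIFICATE. Every bounded ℚ-semialgebraic `F` on
`(0,1)` with `∫₀¹ F = 0` is the `s = 0` trace of a Green certificate on the unit square whose other
three edges are trivial. (The naive certificate `A = −∫₀ᵗ F`, `B = (1−s)F` is the in-class PRIMITIVE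
forbidden by the barrier `noSemialgebraicPrimitive_inv_sub_two`; a semialgebraic certificate
exists for an arithmetic reason: Wüstholz's analytic subgroup theorem (HW2022 Thm 6.2/9.7) applied
to the one real logarithm `u = I(Γ)` of the concatenated path `Γ` in the product `G` of generalised
Jacobians, the REALITY of `(H ∩ σH)°`, and a semialgebraic null-homotopy in `G(ℝ)°` pulled back
along the invariant form.) -/
def GreenSquareCertificate : Prop :=
  ∀ (F : ℝ → ℝ), IsSemialgebraicFunOn ℚ {z : Fin 1 → ℝ | z 0 ∈ Ioo (0:ℝ) 1} (fun z => F (z 0)) →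
    (∃ M : ℝ, ∀ t ∈ Ioo (0:ℝ) 1, |F t| ≤ M) → ∫ t in Ioo (0:ℝ) 1, F t = 0 →
    ∃ A B : (Fin 2 → ℝ) → ℝ, IsGreenSquareData F A B

/-- THE PLANAR ENGINE of card A (shared in kind with PlanarCompiler's Green half and with
10042's `stub_greenOnSquare`): a Green certificate puts the signed cell of `F` into the planar
set-chain group — equal-Jacobian shears `Ψ_s = (s, A)`, `Ψ_t = (t, B)` on the doubly-monotone CAD
cells of `{∂_t A ≠ 0} ∩ W`, the one-dimensional degree formula on slices, and the indicator
criterion `Σ εⱼ 1_{Sⱼ} = 1_X − 1_Y a.e. ⇒ Σ εⱼ[Sⱼ] ≡ [X] − [Y] (mod 1a)`. -/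
def GreenSquareRealisation : Prop :=
  ∀ (F : ℝ → ℝ) (A B : (Fin 2 → ℝ) → ℝ), IsGreenSquareData F A B →
    ∀ (rp rm : KZ.IntegralRep 2),
      rp.domain = {p | p 0 ∈ Ioo (0:ℝ) 1 ∧ 0 < p 1 ∧ p 1 < F (p 0)} →
      rm.domain = {p | p 0 ∈ Ioo (0:ℝ) 1 ∧ 0 < p 1 ∧ p 1 < -F (p 0)} →
      (∀ p ∈ rp.domain, rp.integrand p = 1) → (∀ p ∈ rm.domain, rm.integrand p = 1) →
        KZ.of rp - KZ.of rm ∈ planarGroup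

/-- CELL NORMAL FORM (card A, planar and transcendence-free): two planar integrand-1 regions
differ, in the planar group, from the signed cell of ONE bounded semialgebraic `F` on `(0,1)` whose
integral is the difference of the areas (CAD into 2-cells, vertical shears onto subgraphs,
`(x,u) ↦ (1/x, ux²)` compactification, `(t,y) ↦ (√t, 2√t·y)` desingularisation, affine
reparametrisation and concatenation of the cells side by side — rules 1a and 2 only). -/
def CellNormalForm : Prop :=
  ∀ (r r' : KZ.IntegralRep 2), (∀ p ∈ r.domain, r.integrand p = 1) →
    (∀ p ∈ r'.domain, r'.integrand p = 1) →
    ∃ (F : ℝ → ℝ) (rp rm : KZ.IntegralRep 2),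
      IsSemialgebraicFunOn ℚ {z : Fin 1 → ℝ | z 0 ∈ Ioo (0:ℝ) 1} (fun z => F (z 0)) ∧
      (∃ M : ℝ, ∀ t ∈ Ioo (0:ℝ) 1, |F t| ≤ M) ∧
      ∫ t in Ioo (0:ℝ) 1, F t = r.value - r'.value ∧
      rp.domain = {p | p 0 ∈ Ioo (0:ℝ) 1 ∧ 0 < p 1 ∧ p 1 < F (p 0)} ∧
      rm.domain = {p | p 0 ∈ Ioo (0:ℝ) 1 ∧ 0 < p 1 ∧ p 1 < -F (p 0)} ∧
      (∀ p ∈ rp.domain, rp.integrand p = 1) ∧ (∀ p ∈ rm.domain, rm.integrand p = 1) ∧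
      KZ.of r - KZ.of r' - (KZ.of rp - KZ.of rm) ∈ planarGroup

/-- ARCHITECTURE CHECK (logic only): card A's three statements conclude the crux BY NAME. -/
theorem planarK0Injective_of (hN : CellNormalForm) (hC : GreenSquareCertificate)
    (hR : GreenSquareRealisation) :
    Summit.KontsevichZagierPeriods.KontsevichZagierPeriods.Theses.SymplecticScissors.PlanarK0Injective := by
  intro r r' hr hr' hval
  obtain ⟨F, rp, rm, hF, hM, hint, hdp, hdm, hip, him, hmem⟩ := hN r r' hr hr'
  have h0 : ∫ t in Ioo (0:ℝ) 1, F t = 0 := by rw [hint, hval, sub_self]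
  obtain ⟨A, B, hAB⟩ := hC F hF hM h0
  have hcell : KZ.of rp - KZ.of rm ∈ planarGroup := hR F A B hAB rp rm hdp hdm hip him
  have key : KZ.of r - KZ.of r' ∈ planarGroup := by
    have h := planarGroup.add_mem hmem hcell
    simpa using h
  exact key

/-- ELLIPTIC LAYER of card A, typed today (first lemma of the card). For a non-CM lattice with real
algebraic invariants `g₂, g₃` and `E : y² = 4x³ − g₂x − g₃`, take finitely many first-kind cells
`cᵢ = {aᵢ < x < bᵢ, 0 < y < dᵢ/√(4x³ − g₂x − g₃)}` (`aᵢ < bᵢ`, `dᵢ > 0` real algebraic, the cubic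
positive on `[aᵢ, bᵢ]`) with integer multiplicities `εᵢ`. If `Σ εᵢ · area(cᵢ) = 0` then
`Σ εᵢ [cᵢ]` lies in the planar set-chain group. Transcendence input: `analyticSubgroupTheorem_GaGmE`
with `ι = ∅`, `x = 1`, which turns the `(ℚ̄∩ℝ)`-relation `Σ εᵢ dᵢ zᵢ = 0` among the real elliptic
logarithms `zᵢ` into INTEGER relations; an integer relation is the cell of a null-homotopic loop in
the one-dimensional group `E(ℝ)°` (translated arcs have IDENTICAL planar cells by invariance of
`dx/y`), which cancels arc by arc under rule 1a after one `FiniteMapShear` per monotone piece —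
no Green instance, no rule 1b, no Newton–Leibniz. -/
def EllipticCellsK0 : Prop :=
  ∀ (L : PeriodPair), IsAlgebraic ℚ L.g₂ → IsAlgebraic ℚ L.g₃ → ¬ L.HasCM →
    (L.g₂).im = 0 → (L.g₃).im = 0 →
    ∀ (n : ℕ) (a b d : Fin n → ℝ) (ε : Fin n → ℤ) (r : Fin n → KZ.IntegralRep 2),
      (∀ i, IsAlgebraic ℚ (a i) ∧ IsAlgebraic ℚ (b i) ∧ IsAlgebraic ℚ (d i)) →
      (∀ i, a i < b i ∧ 0 < d i) →
      (∀ i, ∀ x ∈ Icc (a i) (b i), 0 < 4 * x ^ 3 - (L.g₂).re * x - (L.g₃).re) →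
      (∀ i, (r i).domain = {q | a i < q 0 ∧ q 0 < b i ∧ 0 < q 1 ∧
          q 1 < d i / Real.sqrt (4 * q 0 ^ 3 - (L.g₂).re * q 0 - (L.g₃).re)}) →
      (∀ i, ∀ q ∈ (r i).domain, (r i).integrand q = 1) →
      ∑ i, (ε i : ℝ) * (r i).value = 0 →
        ∑ i, ε i • KZ.of (r i) ∈ planarGroup

/-- First lemma of card A as an implication from the tree's named fact. -/
def EllipticCellsK0_of_AST : Prop :=
  analyticSubgroupTheorem_GaGmE → EllipticCellsK0

/-- TORIC / LIOUVILLIAN LAYER (first lemma of card B). Rectangles `(0,1) × (0,cᵢ)`, log-cells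
`{1 < x < βⱼ, 0 < y < bⱼ/x}` and arctan-cells `{sₗ < x < s'ₗ, 0 < y < eₗ/(1 + x²)}` with real algebraic
parameters and integer multiplicities: if the total signed area vanishes, the signed sum of classes
lies in the planar set-chain group. Input: Baker's theorem `baker` (PROVED: `baker_holds`) applied to
the real logs `log βⱼ` and the purely imaginary logs `i(arctan s' − arctan s)` of the UNIMODULAR
algebraic numbers `(1+is')(1−is)/|…|` — a ℤ-dependence among these splits into its real part (a
multiplicative relation, realised by dilations `(x,y) ↦ (x/β, βy)` and cuts) and its imaginary part
(an angle relation, realised by rotations with algebraic entries / Möbius shears preserving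
`dx/(1+x²)`), so the feared log/argument mixing (LevelPairing stmt-4698) never occurs. -/
def PlanarBaker : Prop :=
  ∀ (n₁ n₂ n₃ : ℕ) (c : Fin n₁ → ℝ) (μ : Fin n₁ → ℤ)
    (β b : Fin n₂ → ℝ) (ν : Fin n₂ → ℤ)
    (s s' e : Fin n₃ → ℝ) (ρ : Fin n₃ → ℤ)
    (q₁ : Fin n₁ → KZ.IntegralRep 2) (q₂ : Fin n₂ → KZ.IntegralRep 2)
    (q₃ : Fin n₃ → KZ.IntegralRep 2),
    (∀ i, IsAlgebraic ℚ (c i) ∧ 0 < c i) →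
    (∀ j, IsAlgebraic ℚ (β j) ∧ IsAlgebraic ℚ (b j) ∧ 1 < β j ∧ 0 < b j) →
    (∀ l, IsAlgebraic ℚ (s l) ∧ IsAlgebraic ℚ (s' l) ∧ IsAlgebraic ℚ (e l) ∧ s l < s' l ∧ 0 < e l) →
    (∀ i, (q₁ i).domain = {p | 0 < p 0 ∧ p 0 < 1 ∧ 0 < p 1 ∧ p 1 < c i}) →
    (∀ j, (q₂ j).domain = {p | 1 < p 0 ∧ p 0 < β j ∧ 0 < p 1 ∧ p 1 < b j / p 0}) →
    (∀ l, (q₃ l).domain = {p | s l < p 0 ∧ p 0 < s' l ∧ 0 < p 1 ∧ p 1 < e l / (1 + p 0 ^ 2)}) →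
    (∀ i, ∀ p ∈ (q₁ i).domain, (q₁ i).integrand p = 1) →
    (∀ j, ∀ p ∈ (q₂ j).domain, (q₂ j).integrand p = 1) →
    (∀ l, ∀ p ∈ (q₃ l).domain, (q₃ l).integrand p = 1) →
    ∑ i, (μ i : ℝ) * (q₁ i).value + ∑ j, (ν j : ℝ) * (q₂ j).value
        + ∑ l, (ρ l : ℝ) * (q₃ l).value = 0 →
      ∑ i, μ i • KZ.of (q₁ i) + ∑ j, ν j • KZ.of (q₂ j) + ∑ l, ρ l • KZ.of (q₃ l)
        ∈ planarGroup

/-- First lemma of card B as an implication from a THEOREM of the tree. -/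
def PlanarBaker_of_baker : Prop :=
  baker.{0} → PlanarBaker

/-- Sanity: the antecedent of `PlanarBaker_of_baker` is available sorry-free in the tree. -/
example : baker.{0} := baker_holds

/-- CALIBRATION for card A's reality principle `(H ∩ σH)°`: the j = 0 twist relation
`∫_{-1}^{∞} dx/√(x³+1) = √3 · ∫_{1}^{∞} dx/√(x³−1)`, whose complex explanation is the non-real
isomorphism `(x,y) ↦ (−x, iy)` composed with CM, is realised by the REAL 3-isogeny
`y² = x³ + 1 → y² = x³ − 27 ≅_{ℚ(√3)} y² = x³ − 1` (`X = (x³+4)/x²`, 3 : 1 on real loci,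
`ψ^*(dx/y) = √3·dx/y`): finitely many `FiniteMapShear` pieces, stacking of the three sheets, and
`3·S_{1/√3} = S_{√3}` in the planar group. -/
def TwistCalibration : Prop :=
  ∀ (r r' : KZ.IntegralRep 2),
    r.domain = {p | -1 < p 0 ∧ 0 < p 1 ∧ p 1 < 1 / Real.sqrt (p 0 ^ 3 + 1)} →
    r'.domain = {p | 1 < p 0 ∧ 0 < p 1 ∧ p 1 < Real.sqrt 3 / Real.sqrt (p 0 ^ 3 - 1)} →
    (∀ p ∈ r.domain, r.integrand p = 1) → (∀ p ∈ r'.domain, r'.integrand p = 1) →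
      KZ.of r - KZ.of r' ∈ planarGroup

end Summit.KontsevichZagierPeriods.KontsevichZagierPeriods.Cruxes.PlanarK0Injective.Ideator2
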